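import Mathlib
import Summits.Ventures.PercRepro2.TypedRootMonoRed

/-!
# Root-edge monotonicity of the typed bases, II: the candidate, typed, and what it gives
(blind cell PercRepro2, night-3 g18, 2026-08-27; NIGHT3-CERT.md §26.14 / §27)

(ROOT-MONO-o), the candidate of night-3 g17: for the kernel `K₃` of (HCOV), adding a NEW typed edge
`f = {o, a₁}` of type `1` (pinned closed and untyped in the instance) never decreases the typed
count, `N(F) ≤ N(F + f)`; (ROOT-MONO-b) the same with `f = {b, a₁}`. Exact census: 0 violations on
every abstract instance with `≤ 7` typed edges (1,629,331,168 instances per mark at `a = 5..7`,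
kit j289712; 145,220 per mark at `a ≤ 4`); the `a₃` version fails from `a = 2`. NOT claimed
proved — `RootMonoO` / `RootMonoB` are `def`s (Props). In the kernel, from the reductions of
`TypedRootMonoRed.lean`:

* `typedCount_two_nonneg_of_rootMonoO` — (ROOT-MONO-o) gives the open `(1, 2)` typed base at
  NEG-191's attachment `o ~ {u, a₁}`;
* `doubleClass_ge_of_rootMonoO` — hence the sharp bound `−N(τ[f := 0]) ≤ D₂` on the double class
  there (`doubleClass_eq_two_sub`);
* `typedCount_two_nonneg_of_rootMonoB` — the `b`-twin.

Own work; standard axioms.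
-/

namespace Summit.Ventures.PercRepro2

namespace CovForm

section Defs

variable {V : Type*} {E : Type*} [Fintype E] [DecidableEq E] {R : Type*} [Field R]
  [LinearOrder R] [IsStrictOrderedRing R]

/-- **(ROOT-MONO-o), a CANDIDATE (not claimed proved)**: adding a new type-`1` edge `f = {o, a₁}`
(pinned closed and untyped in the instance) never decreases the typed count of `K₃`. -/
def RootMonoO (ends : E → Sym2 V) (o a₁ a₂ a₃ b : V) : Prop :=
  ∀ (F : Finset E) (z : Config E) (τ : E → ℕ) (f : E), ends f = s(o, a₁) → f ∉ F → z f = false →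
    (∀ e ∈ F, τ e = 1 ∨ τ e = 2) →
    typedCount F z τ (K3 ends o a₁ a₂ a₃ b : Config E → Config E → Config E → R) ≤
      typedCount (insert f F) z (Function.update τ f 1) (K3 ends o a₁ a₂ a₃ b)

/-- **(ROOT-MONO-b), a CANDIDATE (not claimed proved)**: the same with a new type-`1` edge
`f = {b, a₁}`. -/
def RootMonoB (ends : E → Sym2 V) (o a₁ a₂ a₃ b : V) : Prop :=
  ∀ (F : Finset E) (z : Config E) (τ : E → ℕ) (f : E), ends f = s(b, a₁) → f ∉ F → z f = false →
    (∀ e ∈ F, τ e = 1 ∨ τ e = 2) →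
    typedCount F z τ (K3 ends o a₁ a₂ a₃ b : Config E → Config E → Config E → R) ≤
      typedCount (insert f F) z (Function.update τ f 1) (K3 ends o a₁ a₂ a₃ b)

end Defs

namespace TypedRed

open OneTyped

section Main

open Classical

variable {V : Type*} {E : Type*} [Fintype E] [DecidableEq E] {R : Type*} [Field R]
  [LinearOrder R] [IsStrictOrderedRing R]

variable (ends : E → Sym2 V) (o a₁ a₂ a₃ b : V)

/-- **(ROOT-MONO-o) gives the `(1, 2)` base at NEG-191's attachment.** -/
theorem typedCount_two_nonneg_of_rootMonoO (h : RootMonoO (R := R) ends o a₁ a₂ a₃ b) {e f : E}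
    (hf : ends f = s(o, a₁)) (hef : e ≠ f) (ho1 : o ≠ a₁) (ho2 : o ≠ a₂) (ho3 : o ≠ a₃)
    (hob : o ≠ b) (F : Finset E) (heF : e ∈ F) (hfF : f ∉ F) (z : Config E) (hzf : z f = false)
    (τ : E → ℕ) (hτe : τ e = 1) (hτ : ∀ e ∈ F, τ e = 1 ∨ τ e = 2)
    (hcl : ∀ e', e' ≠ e → e' ≠ f → o ∈ ends e' → e' ∉ F ∧ z e' = false) :
    0 ≤ typedCount (insert f F) z (Function.update τ f 2)
      (K3 ends o a₁ a₂ a₃ b : Config E → Config E → Config E → R) :=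
  (rootMonoO_deg_one_iff ends o a₁ a₂ a₃ b hf hef ho1 ho2 ho3 hob F heF hfF z hzf τ hτe hcl).1
    (h F z τ f hf hfF hzf hτ)

/-- **(ROOT-MONO-o) gives the sharp bound on the double class**: at `e = {o, u}`, `f = {o, a₁}` of
types `(1, 1)` (the other edges at `o` pinned closed), `−N(τ[f := 0]) ≤ D₂`. -/
theorem doubleClass_ge_of_rootMonoO (h : RootMonoO (R := R) ends o a₁ a₂ a₃ b) {e f : E} {u : V}
    (he : ends e = s(o, u)) (hf : ends f = s(o, a₁)) (hou : o ≠ u) (hef : e ≠ f) (ho1 : o ≠ a₁)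
    (ho2 : o ≠ a₂) (ho3 : o ≠ a₃) (hob : o ≠ b) (F : Finset E) (heF : e ∈ F) (hfF : f ∈ F)
    (z : Config E) (τ : E → ℕ) (hτe : τ e = 1) (hτf : τ f = 1) (hτ : ∀ e ∈ F, τ e = 1 ∨ τ e = 2)
    (hcl : ∀ e', e' ≠ e → e' ≠ f → o ∈ ends e' → e' ∉ F ∧ z e' = false) :
    -typedCount F z (Function.update τ f 0)
        (K3 ends o a₁ a₂ a₃ b : Config E → Config E → Config E → R) ≤
      doubleClass F z τ e f (K3 ends o a₁ a₂ a₃ b) := by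
  rw [doubleClass_eq_two_sub ends o a₁ a₂ a₃ b he hf hou hef ho1 ho2 ho3 hob F heF hfF z τ hτe hτf
    hcl]
  -- the `(1, 2)` base on `F = insert f (F.erase f)` with `z` closed at `f`
  have hF : insert f (F.erase f) = F := Finset.insert_erase hfF
  have h2 := typedCount_two_nonneg_of_rootMonoO ends o a₁ a₂ a₃ b h hf hef ho1 ho2 ho3 hob
    (F.erase f) (Finset.mem_erase.2 ⟨hef, heF⟩) (Finset.notMem_erase f F)
    (Function.update z f false) (Function.update_self _ _ _) τ hτe
    (fun e he => hτ e (Finset.mem_of_mem_erase he)) (fun e' h1 h2 ho => ?_)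
  · rw [hF, typedCount_congr_z F (z := Function.update z f false) (z' := z)
      (fun e he => Function.update_of_ne (fun h => he (by rw [h]; exact hfF)) _ _) _ _] at h2
    linarith
  · obtain ⟨hF', hz⟩ := hcl e' h1 h2 ho
    exact ⟨fun h => hF' (Finset.mem_of_mem_erase h), by rw [Function.update_of_ne h2]; exact hz⟩

/-- **(ROOT-MONO-b) gives the `(1, 2)` base at a root edge of `b`.** -/
theorem typedCount_two_nonneg_of_rootMonoB (h : RootMonoB (R := R) ends o a₁ a₂ a₃ b) {e f : E}
    (hf : ends f = s(b, a₁)) (hef : e ≠ f) (hbo : b ≠ o) (hb1 : b ≠ a₁) (hb2 : b ≠ a₂)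
    (hb3 : b ≠ a₃) (F : Finset E) (heF : e ∈ F) (hfF : f ∉ F) (z : Config E) (hzf : z f = false)
    (τ : E → ℕ) (hτe : τ e = 1) (hτ : ∀ e ∈ F, τ e = 1 ∨ τ e = 2)
    (hcl : ∀ e', e' ≠ e → e' ≠ f → b ∈ ends e' → e' ∉ F ∧ z e' = false) :
    0 ≤ typedCount (insert f F) z (Function.update τ f 2)
      (K3 ends o a₁ a₂ a₃ b : Config E → Config E → Config E → R) :=
  (rootMonoB_deg_one_iff ends o a₁ a₂ a₃ b hf hef hbo hb1 hb2 hb3 F heF hfF z hzf τ hτe hcl).1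
    (h F z τ f hf hfF hzf hτ)

end Main

end TypedRed

end CovForm

end Summit.Ventures.PercRepro2
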